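import Literature.NumberTheory.EllipticCurves.LegendreFormGoodModelProofs
import Literature.NumberTheory.EllipticCurves.LegendreFourTorsionProofs
import HarnessLib

/-!
# The Legendre equation `y² = x(x−1)(x−λ)` and `K`-rational `2`-torsion ([ExpEst] Remark 5.3.4, as printed):
# the converse direction PROVED, and the literal forward direction ("isomorphic over `K`") tested over `K = ℚ`
# — `y² = x³ − 9x` has all its `2`-torsion rational but admits NO `ℚ`-rational change of variables to a
# Legendre equation (kernel certificate)

`Proofs` file (theorems only; no definitions, no named facts, no instances), topic
`NumberTheory/EllipticCurves`; sequel of `LegendreFormValuation` / `LegendreFormGoodModelProofs` (the Legendre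
equation is the literal `⟨0, −(1 + λ), 0, λ, 0⟩`, `legendre_isElliptic_iff`) and of `LegendreFourTorsionProofs`
(`WeierstrassCurve.Affine.legendre_nonsingular_zero/_one`, `legendre_two_smul_zero/_one`: the `2`-torsion points
`(0,0)`, `(1,0)`). Written by the cross-ladder
literature-typing seat lit-abc-explicitiut (cell abc-iut) while typing

> S. Mochizuki, I. Fesenko, Y. Hoshi, A. Minamide, W. Porowski, *Explicit estimates in inter-universal
> Teichmüller theory*, Kodai Math. J. **45** (2022) 175–236 [ExpEst; bib `MochizukiEtAl2022`, D-0012 claim key],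
> **Remark 5.3.4** (journal p. 223 l. 5–13 = pdf p49.l5–13 of the cell render `run/shared/lean/pub/abc-iut/plan/
> repair/lit/renders/MFHMP-ExplicitEstimates-Kodai2022-book-anonnd-eeiutp`; kurims ms `paper:url-282b4741d9d5`
> p. 46 l. 22–30, word-identical): "Let `K` be a field such that `2` is invertible in `K`, `E` an elliptic curve
> over `K` whose `2`-torsion points are `K`-rational. Then, by considering global sections, with suitable leading
> terms, of tensor powers of the line bundle on `E` determined by the origin [cf., e.g., [Hts], Chapter IV, the
> proof of Proposition 4.6], one concludes immediately that there exists `λ ∈ K^⑂` such that `E` is isomorphic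
> over `K` to the elliptic curve over `K` defined by the equation `y² = x(x − 1)(x − λ)`. Conversely, one verifies
> immediately that the `2`-torsion points of any elliptic curve `E_λ` over `K` defined by an equation of the form
> `y² = x(x−1)(x−λ)` for some `λ ∈ K^⑂` are rational over `K`."

A CLASSICAL side remark of [ExpEst] (no Θ-data; nothing of [IUTchIII] Cor. 3.12 involved; Theorem 5.3 and
Remark 5.3.3 define `E_{a,b,c}`, `E_λ` directly by Legendre equations and do not use it). TAKES NO SIDE on
anything disputed; no abc claim. What is here:

* **Second sentence (converse), PROVED over any field** (`legendre_neg_some_eq_self`, `legendre_nonsingular_self`,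
  `legendre_two_torsion_iff`; the points `(0,0)`, `(1,0)` are the tree's `WeierstrassCurve.Affine.legendre_nonsingular
  _zero/_one`, `legendre_two_smul_zero/_one` of `LegendreFourTorsionProofs`, cited BY NAME): on `E_λ = ⟨0, −(1+λ), 0, λ, 0⟩` the points
  `(0,0), (1,0), (λ,0)` are `K`-rational nonsingular points (for `λ ≠ 0, 1`) fixed by negation, and — when `2 ≠ 0`
  in `K` — a nonsingular affine point `P = (x, y)` satisfies `−P = P` iff `y = 0` iff `(x, y) ∈ {(0,0), (1,0),
  (λ,0)}`; applied over any extension field `K′` (where `E_λ ⊗ K′` is the Legendre equation of `λ ∈ K′`) this is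
  "the `2`-torsion points of `E_λ` are rational over `K`" (Silverman AEC III.1.7 / proof of III.1.7 (a)).
* **First sentence, read literally, TESTED over `K = ℚ`** (the `…_exNine` theorems; the curve `E₀ : y² = x³ −
  9x = ⟨0, 0, 0, −9, 0⟩`): `E₀` is elliptic (`Δ = 2⁶·3⁶`), its three points `(0,0), (3,0), (−3,0)` are `ℚ`-rational
  and fixed by negation (so `E₀(ℚ)[2] = E₀(ℚ̄)[2]`, all `2`-torsion rational), and there is NO `λ ∈ ℚ` and NO
  admissible change of variables `C = (u, r, s, t)` with `u ∈ ℚ^×`, `r, s, t ∈ ℚ` (Mathlib's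
  `WeierstrassCurve.VariableChange ℚ`, i.e. the `ℚ`-isomorphisms of Weierstrass models, Silverman AEC III.3.1 (b))
  carrying `E₀` to a Legendre equation `⟨0, −(1+λ), 0, λ, 0⟩` (`not_exists_variableChange_exNine_eq_legendre`): the
  coefficient identities force `s = t = 0`, `r ∈ {0, 3, −3}` and then `u⁻²` would be a rational square root of
  `1/9·{…}` — precisely `3·(u⁻¹)² = 1`, or `18w² + 9w + 1 = 0` with `w = u⁻² > 0`, or `(3w − 1)(6w − 1) = 0`; none has
  a rational solution (`3`, `6` are not rational squares). READING recorded by this certificate (bookkeeping, no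
  judgement): with "isomorphic over `K`" read as `K`-isomorphism of elliptic curves (= `K`-rational admissible
  change of Weierstrass coordinates), the first sentence does not hold at `K = ℚ`, `E = E₀`; it holds over `K̄`
  (Silverman AEC Prop. III.1.7 (a)) and over `K(√(e₂ − e₁))` — the rescaling `u = √(e₂ − e₁)` of the tree's
  `smul_sq_eq_legendre` / `smul_eq_of_isRoot_Ψ₂Sq` (`LegendreFormValuation`) — i.e. up to a quadratic twist, which
  is all that the `j`-invariant statements of [ExpEst] §5 use.

## References
* [MochizukiEtAl2022] Mochizuki–Fesenko–Hoshi–Minamide–Porowski, Kodai Math. J. 45 (2022), Rmk 5.3.4 p. 223.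
* [SilvermanAEC2009] J. H. Silverman, *The Arithmetic of Elliptic Curves*, 2nd ed., Prop. III.1.7 and its proof
  (Legendre form over `K̄`), Prop. III.3.1 (b) (isomorphisms of Weierstrass models = admissible changes of variables).
-/

namespace Literature.NumberTheory.EllipticCurves

namespace LegendreTwoTorsion

open WeierstrassCurve

section Converse

variable {F : Type*} [Field F]

/-- `(λ, 0)` is a nonsingular point of `y² = x(x−1)(x−λ)` when `λ ≠ 0, 1` (`∂/∂x = −λ(λ − 1) ≠ 0` there); the
companions `(0,0)`, `(1,0)` are the tree's `WeierstrassCurve.Affine.legendre_nonsingular_zero/_one`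
(`LegendreFourTorsionProofs`). [cite: MochizukiEtAl2022, Rmk 5.3.4 p. 223 l. 11–13] -/
theorem legendre_nonsingular_self {la : F} (h0 : la ≠ 0) (h1 : la ≠ 1) :
    (⟨0, -(1 + la), 0, la, 0⟩ : WeierstrassCurve F).toAffine.Nonsingular la 0 := by
  rw [Affine.nonsingular_iff']
  refine ⟨by rw [Affine.equation_iff']; ring, Or.inl ?_⟩
  intro h
  have : la * (la - 1) = 0 := by linear_combination -h
  rcases mul_eq_zero.1 this with h | h
  · exact h0 h
  · exact h1 (sub_eq_zero.1 h)

/-- On the Legendre equation (`a₁ = a₃ = 0`) every nonsingular affine point with `y = 0` is fixed by negation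
(`−(x, 0) = (x, −0) = (x, 0)`): the points `(0,0), (1,0), (λ,0)` are `K`-RATIONAL points of order dividing `2`.
Second sentence of the Remark ("Conversely, … the `2`-torsion points of … `E_λ` … are rational over `K`"),
rational-points half. [cite: MochizukiEtAl2022, Rmk 5.3.4 p. 223 l. 11–13] -/
theorem legendre_neg_some_eq_self {la x : F}
    (h : (⟨0, -(1 + la), 0, la, 0⟩ : WeierstrassCurve F).toAffine.Nonsingular x 0) :
    -Affine.Point.some x 0 h = Affine.Point.some x 0 h := by
  rw [Affine.Point.neg_some, Affine.Point.some.injEq]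
  exact ⟨rfl, by simp [Affine.negY]⟩

/-- **Second sentence of the Remark, PROVED**: over a field with `2 ≠ 0`, a nonsingular affine point `P = (x, y)` of
`E_λ : y² = x(x−1)(x−λ)` is fixed by negation (i.e. `2P = O`) iff `y = 0`, iff `(x, y)` is one of `(0,0), (1,0), (λ,0)`
— all with coordinates in the ground field. Applied with `F` any extension field `K′ ⊇ K` (the base change of
`E_λ` is the Legendre equation of `λ ∈ K′`), this says that every `2`-torsion point of `E_λ` is `K`-rational
(Silverman AEC III.1.7; the `2`-torsion points are `O` and the points with `y = 0`).
[cite: MochizukiEtAl2022, Rmk 5.3.4 p. 223 l. 11–13] [cite: SilvermanAEC2009, Prop. III.1.7 (proof)] -/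
theorem legendre_two_torsion_iff (h2 : (2 : F) ≠ 0) {la x y : F}
    (h : (⟨0, -(1 + la), 0, la, 0⟩ : WeierstrassCurve F).toAffine.Nonsingular x y) :
    -Affine.Point.some x y h = Affine.Point.some x y h ↔ y = 0 ∧ (x = 0 ∨ x = 1 ∨ x = la) := by
  rw [Affine.Point.neg_some, Affine.Point.some.injEq]
  have hneg : (⟨0, -(1 + la), 0, la, 0⟩ : WeierstrassCurve F).toAffine.negY x y = -y := by
    simp [Affine.negY]
  rw [hneg]
  have heq := (Affine.equation_iff' x y).1 h.1
  constructor
  · rintro ⟨-, hy⟩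
    have hy0 : y = 0 := by
      have : (2 : F) * y = 0 := by linear_combination -hy
      rcases mul_eq_zero.1 this with h' | h'
      · exact absurd h' h2
      · exact h'
    refine ⟨hy0, ?_⟩
    have hx : x * (x - 1) * (x - la) = 0 := by
      rw [hy0] at heq; linear_combination -heq
    rcases mul_eq_zero.1 hx with hx | hx
    · rcases mul_eq_zero.1 hx with hx | hx
      · exact Or.inl hx
      · exact Or.inr (Or.inl (sub_eq_zero.1 hx))
    · exact Or.inr (Or.inr (sub_eq_zero.1 hx))
  · rintro ⟨hy, -⟩
    exact ⟨rfl, by rw [hy, neg_zero]⟩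

end Converse

/-! ## The first sentence, read literally ("isomorphic over `K`"), over `K = ℚ`: the curve `y² = x³ − 9x` -/

section RationalExample

/-- `Δ(y² = x³ − 9x) = 46656 = 2⁶·3⁶`. [cite: SilvermanAEC2009, §III.1 (discriminant formulae)] -/
theorem Δ_exNine : (⟨0, 0, 0, -9, 0⟩ : WeierstrassCurve ℚ).Δ = 46656 := by
  simp only [WeierstrassCurve.Δ, WeierstrassCurve.b₂, WeierstrassCurve.b₄, WeierstrassCurve.b₆,
    WeierstrassCurve.b₈]
  norm_num

/-- `E₀ : y² = x³ − 9x` over `ℚ` is an elliptic curve (`Δ = 2⁶·3⁶ ≠ 0`). Stated as a theorem, not an instance.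
[cite: SilvermanAEC2009, §III.1 (discriminant formulae)] -/
theorem isElliptic_exNine : (⟨0, 0, 0, -9, 0⟩ : WeierstrassCurve ℚ).IsElliptic :=
  ⟨isUnit_iff_ne_zero.2 (by rw [Δ_exNine]; norm_num)⟩

/-- The three points `(0,0), (3,0), (−3,0)` of `E₀ : y² = x³ − 9x = x(x−3)(x+3)` are `ℚ`-rational nonsingular
points. [cite: SilvermanAEC2009, Prop. III.1.7 (proof)] -/
theorem nonsingular_exNine {e : ℚ} (he : e = 0 ∨ e = 3 ∨ e = -3) :
    (⟨0, 0, 0, -9, 0⟩ : WeierstrassCurve ℚ).toAffine.Nonsingular e 0 := by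
  rw [Affine.nonsingular_iff']
  rcases he with rfl | rfl | rfl <;> exact ⟨by rw [Affine.equation_iff']; norm_num, Or.inl (by norm_num)⟩

/-- … and each is fixed by negation, i.e. is a `ℚ`-rational point of order `2`; together with `O` these are
`4 = #E₀(ℚ̄)[2]` points, so ALL `2`-torsion points of `E₀` are `ℚ`-rational ("an elliptic curve over `K` whose
`2`-torsion points are `K`-rational", the hypothesis of the first sentence; Silverman AEC III.6.4 (b): exactly three
points of exact order `2` over `K̄`, the roots of `x³ − 9x`). [cite: SilvermanAEC2009, Prop. III.1.7 (proof)] -/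
theorem neg_some_exNine_eq_self {e : ℚ} (he : e = 0 ∨ e = 3 ∨ e = -3) :
    -Affine.Point.some e 0 (nonsingular_exNine he) = Affine.Point.some e 0 (nonsingular_exNine he) := by
  rw [Affine.Point.neg_some, Affine.Point.some.injEq]
  exact ⟨rfl, by simp [Affine.negY]⟩

/-- Over a field with `2 ≠ 0`, the points of `E₀ : y² = x³ − 9x` fixed by negation are exactly those with `y = 0`,
i.e. `x ∈ {0, 3, −3}` (so over any extension of `ℚ` the `2`-torsion of `E₀` is the `ℚ`-rational one above).
[cite: SilvermanAEC2009, Prop. III.1.7 (proof)] -/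
theorem two_torsion_exNine_iff {F : Type*} [Field F] (h2 : (2 : F) ≠ 0) {x y : F}
    (h : (⟨0, 0, 0, -9, 0⟩ : WeierstrassCurve F).toAffine.Nonsingular x y) :
    -Affine.Point.some x y h = Affine.Point.some x y h ↔ y = 0 ∧ (x = 0 ∨ x = 3 ∨ x = -3) := by
  rw [Affine.Point.neg_some, Affine.Point.some.injEq]
  have hneg : (⟨0, 0, 0, -9, 0⟩ : WeierstrassCurve F).toAffine.negY x y = -y := by simp [Affine.negY]
  rw [hneg]
  have heq := (Affine.equation_iff' x y).1 h.1
  constructor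
  · rintro ⟨-, hy⟩
    have hy0 : y = 0 := by
      have : (2 : F) * y = 0 := by linear_combination -hy
      rcases mul_eq_zero.1 this with h' | h'
      · exact absurd h' h2
      · exact h'
    refine ⟨hy0, ?_⟩
    have hx : x * (x - 3) * (x + 3) = 0 := by
      rw [hy0] at heq; linear_combination -heq
    rcases mul_eq_zero.1 hx with hx | hx
    · rcases mul_eq_zero.1 hx with hx | hx
      · exact Or.inl hx
      · exact Or.inr (Or.inl (sub_eq_zero.1 hx))
    · exact Or.inr (Or.inr (eq_neg_of_add_eq_zero_left hx))
  · rintro ⟨hy, -⟩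
    exact ⟨rfl, by rw [hy, neg_zero]⟩

/-- `3` and `6` are not squares in `ℚ`. [folklore] -/
private theorem not_isSquare_three_six {n : ℕ} (hn : n = 3 ∨ n = 6) : ¬ IsSquare (n : ℚ) := by
  rw [Rat.isSquare_natCast_iff]
  rintro ⟨r, hr⟩
  have hr3 : r ≤ 3 := by rcases hn with rfl | rfl <;> nlinarith
  interval_cases r <;> omega

/-- **The first sentence, read literally, at `K = ℚ`, `E = E₀ : y² = x³ − 9x` — kernel certificate.** There is NO
`λ ∈ ℚ` and NO admissible change of variables `C = (u; r, s, t)` with `u ∈ ℚ^×`, `r, s, t ∈ ℚ` (Mathlib's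
`WeierstrassCurve.VariableChange ℚ` = the `ℚ`-isomorphisms between Weierstrass models of an elliptic curve over
`ℚ`, Silverman AEC III.3.1 (b)) with `C • E₀ = ⟨0, −(1+λ), 0, λ, 0⟩`. Proof: comparing `a₁, a₃` gives `s = t = 0`;
`a₆` gives `r(r² − 9) = 0`; eliminating `λ` between `a₂` and `a₄` gives `(3r² − 9)w² + 3rw + 1 = 0` with `w = u⁻² = v²`,
`v = u⁻¹ ∈ ℚ^×`: for `r = 0` this is `9w² = 1`, i.e. `3v² = 1`, i.e. `(3v)² = 3`; for `r = 3` the left side is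
`18w² + 9w + 1 > 0`; for `r = −3` it factors as `(3w − 1)(6w − 1) = 0`, i.e. `(3v)² = 3` or `(6v)² = 6` — and `3`, `6`
are not rational squares. Hence `E₀`, all of whose `2`-torsion is `ℚ`-rational (`neg_some_exNine_eq_self`,
`two_torsion_exNine_iff`), is not `ℚ`-isomorphic to any Legendre curve; it becomes one over `ℚ(√3)` (twist), in
line with Silverman AEC III.1.7 (a) (Legendre form over `K̄`). Bookkeeping on the Remark's first sentence as
literally stated; no judgement beyond `K = ℚ`. [cite: MochizukiEtAl2022, Rmk 5.3.4 p. 223 l. 5–10]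
[cite: SilvermanAEC2009, Prop. III.3.1 (b)] -/
theorem not_exists_variableChange_exNine_eq_legendre :
    ¬ ∃ (la : ℚ) (C : VariableChange ℚ),
      C • (⟨0, 0, 0, -9, 0⟩ : WeierstrassCurve ℚ) = ⟨0, -(1 + la), 0, la, 0⟩ := by
  rintro ⟨la, C, h⟩
  have h1 := congrArg WeierstrassCurve.a₁ h
  have h2 := congrArg WeierstrassCurve.a₂ h
  have h3 := congrArg WeierstrassCurve.a₃ h
  have h4 := congrArg WeierstrassCurve.a₄ h
  have h6 := congrArg WeierstrassCurve.a₆ h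
  simp only [variableChange_a₁, variableChange_a₂, variableChange_a₃, variableChange_a₄,
    variableChange_a₆] at h1 h2 h3 h4 h6
  set v : ℚ := ((C.u⁻¹ : ℚˣ) : ℚ) with hv
  have hv0 : v ≠ 0 := (C.u⁻¹).ne_zero
  -- `s = 0`, `t = 0`
  have hs : C.s = 0 := by
    have : v * (2 * C.s) = 0 := by linear_combination h1
    rcases mul_eq_zero.1 this with h' | h'
    · exact absurd h' hv0
    · linarith
  have ht : C.t = 0 := by
    have : v ^ 3 * (2 * C.t) = 0 := by linear_combination h3
    rcases mul_eq_zero.1 this with h' | h'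
    · exact absurd (pow_eq_zero_iff (by norm_num) |>.1 h') hv0
    · linarith
  rw [hs] at h2 h4
  rw [ht] at h4 h6
  -- `r (r² − 9) = 0`
  have hr : C.r * (C.r - 3) * (C.r + 3) = 0 := by
    have : v ^ 6 * (C.r ^ 3 - 9 * C.r) = 0 := by linear_combination h6
    rcases mul_eq_zero.1 this with h' | h'
    · exact absurd (pow_eq_zero_iff (by norm_num) |>.1 h') hv0
    · linear_combination h'
  -- the two remaining identities: `3 r v² = −(1 + λ)` and `(3r² − 9) v⁴ = λ`
  have hA : v ^ 2 * (3 * C.r) = -(1 + la) := by linear_combination h2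
  have hB : v ^ 4 * (3 * C.r ^ 2 - 9) = la := by linear_combination h4
  have hv2 : 0 < v ^ 2 := by positivity
  rcases mul_eq_zero.1 hr with hr' | hr'
  · rcases mul_eq_zero.1 hr' with hr0 | hr3
    · -- `r = 0`: `9 v⁴ = 1`, so `(3v²)² = 1`, `3v² = 1`, `(3v)² = 3`
      rw [hr0] at hA hB
      have h9 : (3 * v ^ 2 - 1) * (3 * v ^ 2 + 1) = 0 := by nlinarith
      rcases mul_eq_zero.1 h9 with h' | h'
      · exact not_isSquare_three_six (Or.inl rfl) ⟨3 * v, by push_cast; nlinarith⟩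
      · nlinarith
    · -- `r = 3`: `18 v⁴ + 9 v² + 1 = 0`, impossible
      have hr3' : C.r = 3 := by linarith
      rw [hr3'] at hA hB
      nlinarith
  · -- `r = −3`: `18 v⁴ − 9 v² + 1 = 0`, i.e. `(3v² − 1)(6v² − 1) = 0`
    have hr3' : C.r = -3 := by linarith
    rw [hr3'] at hA hB
    have h18 : (3 * v ^ 2 - 1) * (6 * v ^ 2 - 1) = 0 := by nlinarith
    rcases mul_eq_zero.1 h18 with h' | h'
    · exact not_isSquare_three_six (Or.inl rfl) ⟨3 * v, by push_cast; nlinarith⟩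
    · exact not_isSquare_three_six (Or.inr rfl) ⟨6 * v, by push_cast; nlinarith⟩

/-- **Summary (the first sentence of [ExpEst] Remark 5.3.4, read with "isomorphic over `K`" = `K`-rational
admissible change of Weierstrass coordinates, at `K = ℚ`)**: there is an elliptic curve over `ℚ` (namely `E₀ :
y² = x³ − 9x`) with three distinct `ℚ`-rational points of order `2` — hence with all its `2`-torsion `ℚ`-rational —
that is not carried by any `C ∈ VariableChange ℚ` to any Legendre equation `y² = x(x−1)(x−λ)`, `λ ∈ ℚ`. (Over `K̄`,
or after adjoining `√(e₂ − e₁)`, the Legendre form exists: Silverman AEC III.1.7 (a); tree `smul_sq_eq_legendre`.)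
[cite: MochizukiEtAl2022, Rmk 5.3.4 p. 223 l. 5–10] [cite: SilvermanAEC2009, Prop. III.1.7 (a)] -/
theorem exists_rational_two_torsion_not_variableChange_legendre :
    ∃ W : WeierstrassCurve ℚ, W.IsElliptic ∧
      (∃ h₁ : W.toAffine.Nonsingular 0 0, -Affine.Point.some 0 0 h₁ = Affine.Point.some 0 0 h₁) ∧
      (∃ h₂ : W.toAffine.Nonsingular 3 0, -Affine.Point.some 3 0 h₂ = Affine.Point.some 3 0 h₂) ∧
      (∃ h₃ : W.toAffine.Nonsingular (-3) 0, -Affine.Point.some (-3) 0 h₃ = Affine.Point.some (-3) 0 h₃) ∧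
      ¬ ∃ (la : ℚ) (C : VariableChange ℚ), C • W = ⟨0, -(1 + la), 0, la, 0⟩ :=
  ⟨⟨0, 0, 0, -9, 0⟩, isElliptic_exNine,
    ⟨nonsingular_exNine (Or.inl rfl), neg_some_exNine_eq_self (Or.inl rfl)⟩,
    ⟨nonsingular_exNine (Or.inr (Or.inl rfl)), neg_some_exNine_eq_self (Or.inr (Or.inl rfl))⟩,
    ⟨nonsingular_exNine (Or.inr (Or.inr rfl)), neg_some_exNine_eq_self (Or.inr (Or.inr rfl))⟩,
    not_exists_variableChange_exNine_eq_legendre⟩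

end RationalExample

end LegendreTwoTorsion

end Literature.NumberTheory.EllipticCurves
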